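import Literature.AlgebraicGeometry.HodgeTheory.ComplexifiedDeRhamFamily
import Literature.AlgebraicGeometry.HodgeTheory.HodgeFiltrationModels
import Literature.Geometry.Kaehler.Kaehler
import HarnessLib

/-!
# The Kähler class is of Hodge type `(1, 1)` (proved): the Kähler form of a Hermitian metric is a `(1,1)`-form, and the class on `X(ℂ)` of a Kähler metric of a Hodge model is of type `(1, 1)`

Family `hodge`, layer `Literature/AlgebraicGeometry/HodgeTheory`. Bottom-up proofs toward the
named facts `nonempty_hardLefschetzNFold n X` / `hodgeIndex_primitiveAlgebraic n X`: the field
`HardLefschetzNFold.isOfHodgeType_lefschetzOperator` ("`L` is of bidegree `(1, 1)` for the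
bigraduation of the cohomology given by the Hodge decomposition", Voisin I Rem. 6.27) is, given
the tree's `CupPreservesHodgeType n X` (file `GysinFormalismHodge`; PROVED from de Rham's theorem
and `hodgePQ_independent_of_hodgeModel` in `CupPreservesHodgeTypeOfDeRham`), exactly the statement
that the class `h = [ω]` is itself of Hodge type `(1, 1)`. This file PROVES that statement for the
class of a Kähler metric on a Hodge model (the class `h ∈ H²(X(ℂ); ℂ)` pulling back to
`e[ω_g] ⊗ 1`, file `HardLefschetzComplexification`):

* `isOfType_one_one_kaehlerForm_ofReal` — **the Kähler form `ω(v, w) = g(Jv, w)` of a HERMITIAN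
  metric (`g(Jv, Jw) = g(v, w)`) is a real form of type `(1, 1)`**: `ω(e^{iθ} v, e^{iθ} w) =
  ω(v, w)` (Voisin I §3.1.1 Lemma 3.3: `ω = -Im h` for the Hermitian form `h`, "`ω` is a real form
  of type `(1,1)`"; pointwise linear algebra with `e^{iθ} = cos θ + sin θ J`).
* `HodgeModel.isOfHodgeType_one_one_of_pullback_eq_kaehlerClass` — for a Hodge model `A` of `X`, a
  smooth metric `g` on `A.carrier` which is Kähler and a NATURAL real de Rham comparison family `e`
  (de Rham's theorem, `exists_deRhamIsoFamily`), the class `h ∈ H²(X(ℂ); ℂ)` with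
  `A^* h = e[ω_g] ⊗ 1` is of Hodge type `(1, 1)` (`IsOfHodgeType n X 2 1 1 h`): in the Hodge model
  `A'` obtained from `A` by replacing its comparison with `e ⊗ ℂ`
  (`DeRhamIsoFamily.complexify`, natural by `complexify_isNatural`; the Hodge decomposition of `A`
  is untouched — the device of `cupPreservesHodgeType_of_exists_deRhamIsoFamily`),
  `A'^* h = (e ⊗ ℂ)[ω_g ⊗ 1]` (`complexifyFun_ofReal`) with `[ω_g ⊗ 1] ∈ H^{1,1}`.

No named fact is introduced (D-0026). Consequence (not restated): with `CupPreservesHodgeType n X`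
the Lefschetz operator of `h` raises Hodge types by `(1, 1)` — the field — whence, by
`isOfHodgeType_of_lefschetzPow_of_independent` (file `HodgeIndexPrimitiveAlgebraicProofs`), also
the descent field.

## References

* [VoisinHodgeI2002] C. Voisin, Hodge Theory and Complex Algebraic Geometry I (CUP 2002), §2.3.1
  (types as weight spaces of the `U(1)`-action), §3.1.1 Lemma 3.3 and (3.1) (`ω = -Im h` is a real
  `(1,1)`-form), §6.2.3 Rem. 6.27, §7.1.3 Thm. 7.10.
* [GriffithsHarris1978] P. Griffiths, J. Harris, Principles of Algebraic Geometry (Wiley 1978),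
  pp. 27–29, 106–109.
-/

noncomputable section

open scoped Manifold ContDiff
open CategoryTheory Bundle

namespace Literature.AlgebraicGeometry.HodgeTheory

section HodgeTheory

open Literature.AlgebraicTopology.SingularHomology Literature.Geometry.Kaehler
open Literature.NumberTheory.Transcendental (DeRhamIsoFamily complexDeRhamCohomology IsOfType
  hodgePQ cclosedSmoothForms tangentRotate)

/-! ### The Kähler form of a Hermitian metric has type `(1, 1)` -/

section Forms

variable {E : Type*} [NormedAddCommGroup E] [NormedSpace ℂ E]
  {M : Type*} [TopologicalSpace M] [ChartedSpace E M]

/-- Rotation by `e^{iθ}` is `cos θ + sin θ · J` on the real tangent space. [cite: VoisinHodgeI2002, §2.3.1] -/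
theorem tangentRotate_eq_cos_add_sin_tangentJ (x : M) (θ : ℝ) (u : TangentSpace 𝓘(ℝ, E) x) :
    tangentRotate E x θ u = Real.cos θ • u + Real.sin θ • tangentJ E x u := by
  change (Complex.exp (θ * Complex.I) • (show E from u) : E) =
    Real.cos θ • (show E from u) + Real.sin θ • (Complex.I • (show E from u) : E)
  rw [Complex.exp_mul_I, ← Complex.ofReal_cos, ← Complex.ofReal_sin, add_smul, mul_smul,
    Complex.coe_smul, Complex.coe_smul]

/-- **The Kähler form of a Hermitian metric is of type `(1, 1)`**: for `g` Hermitian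
(`g(Jv, Jw) = g(v, w)`), the complexified fundamental form `ω ⊗ 1`, `ω(v, w) = g(Jv, w)`, satisfies
`ω(e^{iθ} v, e^{iθ} w) = ω(v, w)` — weight `p - q = 0` with `p + q = 2` ("the `2`-form `ω = -Im h`
… is a real form of type `(1,1)`"). With `e^{iθ} = cos θ + sin θ J`, `J² = -1` and
`g(v, Jw) = -g(Jv, w)`: `g(J e^{iθ} v, e^{iθ} w) = (cos² θ + sin² θ) g(Jv, w)`.
[cite: VoisinHodgeI2002, §3.1.1 Lemma 3.3 and (3.1)] [cite: GriffithsHarris1978, pp. 27–29] -/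
theorem isOfType_one_one_kaehlerForm_ofReal
    (g : RiemannianMetric (fun x : M ↦ TangentSpace 𝓘(ℝ, E) x)) (hg : g.IsHermitian) :
    IsOfType 1 1 (g.kaehlerForm).ofReal := by
  refine ⟨rfl, fun x θ v ↦ ?_⟩
  have hexp : Complex.exp ((((1 : ℕ) : ℤ) - (1 : ℕ) : ℤ) * (θ : ℂ) * Complex.I) = 1 := by simp
  rw [hexp, one_mul, MForm.ofReal_apply, MForm.ofReal_apply]
  congr 1
  -- the real identity `ω(Rv₀, Rv₁) = ω(v₀, v₁)`
  have hv : v = ![v 0, v 1] := by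
    ext i; fin_cases i <;> rfl
  have hRv : (fun i ↦ tangentRotate E x θ (v i)) =
      ![tangentRotate E x θ (v 0), tangentRotate E x θ (v 1)] := by
    ext i; fin_cases i <;> rfl
  rw [hRv, RiemannianMetric.kaehlerForm_apply_of_isHermitian g hg]
  conv_rhs => rw [hv, RiemannianMetric.kaehlerForm_apply_of_isHermitian g hg]
  set a := v 0
  set b := v 1
  have hJR : tangentJ E x (tangentRotate E x θ a) = Real.cos θ • tangentJ E x a - Real.sin θ • a := by
    rw [tangentRotate_eq_cos_add_sin_tangentJ, map_add, map_smul, map_smul, tangentJ_tangentJ,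
      smul_neg, sub_eq_add_neg]
  rw [hJR, tangentRotate_eq_cos_add_sin_tangentJ x θ b]
  simp only [map_add, map_sub, map_smul, sub_apply, smul_apply, smul_eq_mul]
  -- the Hermitian identities `g(Ja, Jb) = g(a, b)`, `g(a, Jb) = -g(Ja, b)`
  have h1 : g.inner x (tangentJ E x a) (tangentJ E x b) = g.inner x a b := hg x a b
  have h2 : g.inner x a (tangentJ E x b) = -g.inner x (tangentJ E x a) b := by
    have h := hg x a (tangentJ E x b)
    rw [tangentJ_tangentJ, map_neg] at h
    exact h.symm
  rw [h1, h2]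
  linear_combination (g.inner x (tangentJ E x a) b) * Real.cos_sq_add_sin_sq θ

/-- The class of the complexified Kähler form of a Kähler metric lies in `H^{1,1} ⊆ H²_dR(M; ℂ)`
(the span of the classes of closed `(1,1)`-forms): `ω ⊗ 1` is closed (`ω` is closed, `g` Kähler),
smooth (`hω`) and of type `(1, 1)` (`isOfType_one_one_kaehlerForm_ofReal`).
[cite: VoisinHodgeI2002, §3.1.1 Lemma 3.3 and §6.1.3] -/
theorem ofReal_kaehlerClass_mem_hodgePQ [FiniteDimensional ℂ E] [IsManifold 𝓘(ℂ, E) ω M]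
    [IsManifold 𝓘(ℝ, E) ∞ M]
    (hω : isSmoothForm_kaehlerForm_of_isManifold_complex (E := E) (M := M))
    (g : ContMDiffRiemannianMetric 𝓘(ℝ, E) ∞ E (fun x : M ↦ TangentSpace 𝓘(ℝ, E) x))
    (hg : g.toRiemannianMetric.IsKaehler) :
    complexDeRhamCohomology.ofReal E M 2 (g.kaehlerClass hω hg) ∈ hodgePQ E M 2 1 1 := by
  change complexDeRhamCohomology.ofReal E M 2 (deRhamCohomology.mk _) ∈ _
  rw [complexDeRhamCohomology.ofReal_mk]
  refine Submodule.subset_span ⟨_, ?_, rfl⟩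
  exact isOfType_one_one_kaehlerForm_ofReal g.toRiemannianMetric hg.isHermitian

end Forms

/-! ### The class of a Kähler metric of a Hodge model is of Hodge type `(1, 1)` -/

section HodgeModels

variable {n : ℕ} {X : Motives.SchemeOver ℂ}

/-- **The Kähler class on `X(ℂ)` is of Hodge type `(1, 1)`.** Let `A` be a Hodge model of `X`, `g`
a smooth Riemannian metric on `A.carrier` which is Kähler, `e` a NATURAL real de Rham comparison
family, and `h ∈ H²(X(ℂ); ℂ)` the class with `A^* h = e[ω_g] ⊗ 1`
(`HodgeModel.existsUnique_pullback_eq_kaehlerClass`). Then `h` is of Hodge type `(1, 1)`: in the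
Hodge model `A'` with the same analytification and Hodge decomposition but comparison `e ⊗ ℂ`
(`DeRhamIsoFamily.complexify`, natural), `A'^* h = A^* h = (e ⊗ ℂ)[ω_g ⊗ 1]`
(`complexifyFun_ofReal`) and `[ω_g ⊗ 1] ∈ H^{1,1}` (`ofReal_kaehlerClass_mem_hodgePQ`). With the
tree's `CupPreservesHodgeType n X` this gives the bidegree-`(1,1)` field of the intended
`HardLefschetzNFold n X` for `g` the restricted Fubini–Study metric.
[cite: VoisinHodgeI2002, §3.1.1 Lemma 3.3, Rem. 6.27 and Thm. 7.10] -/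
theorem HodgeModel.isOfHodgeType_one_one_of_pullback_eq_kaehlerClass (A : HodgeModel n X)
    (hω : isSmoothForm_kaehlerForm_of_isManifold_complex (E := A.model) (M := A.carrier))
    (g : ContMDiffRiemannianMetric 𝓘(ℝ, A.model) ∞ A.model
      (fun x : A.carrier ↦ TangentSpace 𝓘(ℝ, A.model) x))
    (hg : g.toRiemannianMetric.IsKaehler) (e : DeRhamIsoFamily 𝓘(ℝ, A.model)) (he : e.IsNatural)
    {h : complexBetti X 2}
    (hh : A.pullback 2 h = ofRealClass A.carrier 2 (e A.carrier 2 (g.kaehlerClass hω hg))) :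
    IsOfHodgeType n X 2 1 1 h := by
  -- the Hodge model `A'` with comparison `e ⊗ ℂ`
  let A' : HodgeModel n X :=
    { A with
      deRham := e.complexify
      deRham_isNatural := DeRhamIsoFamily.complexify_isNatural he }
  refine ⟨A', ?_⟩
  change A.pullback 2 h ∈ (Literature.NumberTheory.Transcendental.hodgePQ A.model A.carrier 2 1 1).map
    (e.complexifyEquiv A.carrier 2).toLinearMap
  rw [hh]
  refine ⟨complexDeRhamCohomology.ofReal A.model A.carrier 2 (g.kaehlerClass hω hg),
    ofReal_kaehlerClass_mem_hodgePQ hω g hg, ?_⟩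
  change complexifyFun e 2 _ = _
  exact complexifyFun_ofReal e 2 _

end HodgeModels

end HodgeTheory

end Literature.AlgebraicGeometry.HodgeTheory

end
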